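import Summits.QuantumFields.BalabanUV.T4Continuum.Support.NE7ApeCurvedRepRoadBFourTerm
import Summits.QuantumFields.BalabanUV.T4Continuum.Support.NE7SameTopNormalLift
import HarnessLib

/-!
# NE7ApeCurvedRepRoadBLiftedFourTerm — O2 RE-THREAD, FILE 7: `NE7ApeCurvedRepRoadBLiftedH` ((L1)′ DISCHARGED by F111 `NE7SameTopNormalLift.exists_normalLift_sameTop`, `a_N := m`,
# `c_N := 4m`, `ν := 24·#Plane·m`) RE-CUT on F158 `NE7ApeCurvedRepRoadBFourTerm`: the four-term letter `h4` replaces `(S, hS, hG)`; the normal lift's new clauses are DISCHARGED —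
# skewness is an F111 output, its covariant divergence by the CRUDE kinematic bound `‖covDiv W A_N‖ ≤ 2d·a_N` (unitary transport; memo O2(ii) says this pricing is `≍ bCδ²∕M`, one
# power of `M` above the closing order — the successor sharpens it by a smooth∕projected normal lift; until then the END is honest and the desk sees the term); `hDivCorr` (`d_C`)
# stays displayed; conclusion: the lifted road-(B) radius `+ K_D·(d_C + (b₀ + 3c_RE b₀) + 2d·a_N) + K_Ξ·2θ_u` (file 89 of the curved (APE), F159)

Cell `pub-balaban`, rung (B)+1 sub-cell t4, lineage `b2b-balaban-t4-ne7-p1` (CRUX PROVER NE7 #1 = OWNER of row NE7), generation 82; memo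
`t4/b2b-balaban-t4-ne7-p1-g82/LOCALISATION-ROAD.md` §2 (O2).  Twin of `NE7ApeCurvedRepRoadBLiftedH` (gen 80) over F158; F111 BY NAME exactly as there.
WHY.  After this file the curved (APE) with a datum on road (B) reads, on the four-term root: E′ regime + class data + regime lines + the FOUR-TERM letter + α₁ (`hGrad`) + ONE displayed
kinematic letter `hDivCorr` (divergence of the pointing correction) — with `A_N`'s data all discharged.  The successor carries the two new summands through `…RoadBFinal → …Sharp →
…GradientSharp → …M → …Class` (text substitution) and prices∕discharges `hDivCorr` (its object `Z′ − (Z − gaugeDir σ̃) = log`-BCH remainder of F106, face∕bulk structure).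
WHAT ([folklore]; 0 def, 0 sorry).  **`smallField_of_tanCritical_roadB_lifted_fourTerm`**.
HONEST FRAMING (page 1): composition over DISPLAYED letters (four-term letter, α₁, `hDivCorr`) and PROVED suppliers (E′, F109, F111); the crude `2d·a_N` is a kinematic bound, not a
claim that it closes; nothing of Bałaban's asserted; (APE) on curved data NOT proved; NOT ONE-STEP, NOT NE7; spine 0∕9; finite T⁴ rung (B)+1 — NOT infinite volume, NOT mass gap,
NOT `BetaPertH`, NOT Clay.  Continuum YM on T⁴ ⇐ BetaPertH ∧ nine spine estimates (0/9 proved); BetaPertH ⇐ (D1) ∧ (D4) ∧ CAP+tail; G-an2-4 gates asym, D1 and NE2/3/4.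
-/

set_option autoImplicit false

open scoped BigOperators Matrix Matrix.Norms.L2Operator
open NormedSpace Finset

namespace Summit.QuantumFields.BalabanUV.T4Continuum.NE7ApeCurvedRepRoadBLiftedFourTerm

open Literature.MathematicalPhysics.QuantumFieldTheory.Balaban1983to89
open B7Prop1Explicit B7Prop2Explicit MatrixLog UnitaryModel
open T4AveragingDeficitWall (Ad IsUnitaryCfg IsSkewDir SmallField vary curlAt dirL1)
open T4AveragingDeficitWallBoundary (IsPeriodicCfg periodBox)
open AveragingDeficitPeriodicCounting (IsPeriodicDir)
open AveragingDeficitTwoLevelPrep (twoLevelSmall)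
open AveragingDeficitMultiLevelPrep (cavgIter LevelSmall)
open MinimalActionLevels (perWin)
open BlockAverageVaryHolo (nbRad)
open BlockAveragePushDirGauge (gaugeDir)
open NE3HessForm (hess dAction)
open NE3TangentCovariantTower (dirIter)
open NE3EnergyShapes (IsUnitarySite IsPeriodicSite)
open NE3CovariantWeitzenbock (covDiv)
open NE3RightInverseSupLetters (frameC)
open NE3QbarIterCovLiftPrep (cruxC)
open NE3RightInverseSolveLetters (thetaLoc)
open NE3HatInvCurlLetters (curl1C)
open NE3.PairLandauB8 (IsLandauB8)
open BlockAverageVaryDisc (rho0)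
open NE3LinearisedAverageSup (curvSum)
open NE3RightInverseSupLetters (supC)
open NE3RightInverseSolveLetters (cruxC_nonneg)
open NE3ResidualSliceRep (dirIter_sub)
open NE7ApeCurvedRepRoadBFourTerm (smallField_of_tanCritical_roadB_fourTerm)
open AveragingDeficitTransport (norm_Ad_of_unitary)
open NE7SameTopNormalLift (exists_normalLift_sameTop)

noncomputable section

variable {d : ℕ} {n : Type*} [Fintype n] [DecidableEq n]

/-- **ROAD (B) WITH (L1)′ DISCHARGED, FOUR-TERM SLICE-SOLVER LETTER** — `NE7ApeCurvedRepRoadBLiftedH.smallField_of_tanCritical_roadB_lifted` with `(S, hS, hG)` ↦ the four-term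
letter `h4`, the pointing correction's divergence letter `hDivCorr` (`d_C`) displayed, and the normal lift's new clauses DISCHARGED from F111 (`exists_normalLift_sameTop`: skewness by
name; divergence by the CRUDE bound `‖covDiv W A_N‖ ≤ 2d·a_N`, to be sharpened); conclusion = the original radius `+ K_D·(d_C + (b₀ + 3c_RE b₀) + 2d·a_N) + K_Ξ·2θ_u`.
[folklore] -/
theorem smallField_of_tanCritical_roadB_lifted_fourTerm [Nonempty n] (hd : 2 ≤ d) {L N : ℕ} [NeZero N] (hL : 2 ≤ L) (j : ℕ)
    -- the background
    {W : Site d → Fin d → (Matrix n n ℂ)ˣ} {x : ℝ} (hWu : IsUnitaryCfg W) (hWP : IsPeriodicCfg W ((N * L ^ (j + 1) : ℕ) : ℤ))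
    (hx : 0 ≤ x) (hs : LevelSmall d L j x) (hWx : SmallField W x)
    -- the sup radius of the representative and the regime at `x′ = x + 4(e^{α₀} − 1)`
    {α₀ : ℝ} (hα0 : 0 ≤ α₀) (hs' : LevelSmall d L j (x + 4 * (Real.exp α₀ - 1)))
    (hθ : cruxC d L * (((L : ℝ) ^ (j + 1)) ^ 2 * (x + 4 * (Real.exp α₀ - 1))) < 1)
    (hθl : thetaLoc d L * (((L : ℝ) ^ (j + 1)) ^ 2 * (x + 4 * (Real.exp α₀ - 1))) < 1)
    (hε : ((L : ℝ) ^ (j + 1)) ^ 2 * (x + 4 * (Real.exp α₀ - 1)) ≤ 1)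
    -- the field: of the class, tangent-critical, over `W`'s datum
    {U : Site d → Fin d → (Matrix n n ℂ)ˣ} (hUu : IsUnitaryCfg U) (hUP : IsPeriodicCfg U ((N * L ^ (j + 1) : ℕ) : ℤ))
    {xU : ℝ} (hxU : 0 ≤ xU) (hsU : LevelSmall d L j xU) (hUxU : SmallField U xU)
    (hcritU : ∀ Y : Site d → Fin d → Matrix n n ℂ, IsSkewDir Y → IsPeriodicDir Y ((N * L ^ (j + 1) : ℕ) : ℤ) →
      dirIter L (j + 1) U Y = 0 → dAction U Y (perWin d (N * L ^ (j + 1))) = 0)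
    (hTopUW : cavgIter L (j + 1) U = cavgIter L (j + 1) W)
    -- row NE3's class data of `W` and E′'s initial gauge ∕ regime (as in `exists_landauRep_W`), the constant `c_RE` named; road (B)'s two extra regime lines
    {x₁ : ℝ} (hx10 : 0 ≤ x₁)
    (hgrad : ∀ (p : Site d) (μ κ : Fin d), κ ≠ μ →
      ‖Ad (W p μ) ((hol W (p + e μ) (plaqWord κ μ) : (Matrix n n ℂ)ˣ) : Matrix n n ℂ) - ((hol W p (plaqWord κ μ) : (Matrix n n ℂ)ˣ) : Matrix n n ℂ)‖ ≤ x₁)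
    (hbx : 23040 * (d : ℝ) ^ 4 * (frameC d L + d) ^ 2 * ((L : ℝ) ^ (j + 1)) ^ 2 * x ≤ 1)
    (hcx : 11520 * (d : ℝ) ^ 4 * (frameC d L + d) ^ 3 * ((L : ℝ) ^ (j + 1)) ^ 3 * x₁ ≤ 1)
    (hbx' : 256 * (d : ℝ) ^ 2 * ((L : ℝ) ^ (j + 1)) ^ 2 * x ≤ 1) (hcx' : 16 * (d : ℝ) * ((L : ℝ) ^ (j + 1)) ^ 3 * x₁ ≤ 1)
    {r₀ b₀ : ℝ} (hr₀ : ∀ (y : Site d) (μ : Fin d), ‖(((W y μ)⁻¹ * U y μ : (Matrix n n ℂ)ˣ) : (Matrix n n ℂ)) - 1‖ ≤ r₀)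
    (hb₀ : ∀ x : Site d, ‖covDiv W (fun y μ => mlog (((W y μ)⁻¹ * U y μ : (Matrix n n ℂ)ˣ) : (Matrix n n ℂ))) x‖ ≤ b₀)
    {cRE : ℝ} (hcRE : cRE = 1 + 2 * (Fintype.card n : ℝ) * (64 * (d : ℝ) ^ 2 * N) ^ d + 27 * (Fintype.card n : ℝ) ^ 3 * (512 : ℝ) ^ d * (N : ℝ) ^ d)
    (hreg₁ : (36 * (d : ℝ) * (frameC d L + d) ^ 2) * ((L : ℝ) ^ (j + 1)) ^ 2 * (cRE * b₀) ≤ 1 / 10)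
    (hreg₂ : (36 * (d : ℝ) * (frameC d L + d)) * (L : ℝ) ^ (j + 1) * (cRE * b₀) ≤ 1 / 25)
    (hreg₃ : r₀ + 5 / 2 * ((36 * (d : ℝ) * (frameC d L + d)) * (L : ℝ) ^ (j + 1) * (cRE * b₀)) ≤ 1 / 20)
    (hline : cRE * (4 * ((36 * (d : ℝ) * (frameC d L + d) ^ 2) * ((L : ℝ) ^ (j + 1)) ^ 2) * (b₀ + 4 * (cRE * b₀))
        + 25 * d * (r₀ + 5 / 2 * ((36 * (d : ℝ) * (frameC d L + d)) * (L : ℝ) ^ (j + 1) * (cRE * b₀))) * ((36 * (d : ℝ) * (frameC d L + d)) * (L : ℝ) ^ (j + 1))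
        + 14 * d * ((36 * (d : ℝ) * (frameC d L + d)) * (L : ℝ) ^ (j + 1)) ^ 2 * (cRE * b₀)) ≤ 1 / 2)
    -- E′'s radii named: `α_E` (sup radius of `Z`), `θ_u` (sup radius of `u − 1`); road (B)'s regime `α_E ≤ 1∕40`, `θ_u ≤ 1∕160`, and `α₀ ≥ α_E + 4θ_u + 4(6θ_u)(α_E + 4θ_u)`
    {αE θu : ℝ} (hαE : αE = 2 * (r₀ + 5 / 2 * ((36 * (d : ℝ) * (frameC d L + d)) * (L : ℝ) ^ (j + 1) * (cRE * b₀))))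
    (hθu : θu = 4 * ((36 * (d : ℝ) * (frameC d L + d) ^ 2) * ((L : ℝ) ^ (j + 1)) ^ 2 * (cRE * b₀)))
    (hαE40 : αE ≤ 1 / 40) (hθu160 : θu ≤ 1 / 160)
    (hα₀ : αE + 4 * θu + 4 * (2 * θu + 4 * θu) * (αE + 4 * θu) ≤ α₀)
    -- the remaining analytic letters at `W`: (L1)′ and α₁ for the SAME-TOP structured fields of radius `α₀`, (L2), (L3) discharged
    -- (L1)′ DISCHARGED (F111): the quadratic-remainder regime, the slice `S` containing the `W`-tangent skew periodic fields, and the names `c_N = 4m`, `ν = 24·#Plane·m`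
    (hs1 : LevelSmall d L (j + 1) x) (hA : curvSum d L (j + 1) x ≤ 2 / 3 * L) (hσ0 : 4 * (3 + 12 * (d : ℝ)) ^ 2 * (L : ℝ) ^ (j + 1) * α₀ ≤ rho0 d L ^ 2)
    {cN aN dC KG KX KD KΞ ν : ℝ}
    -- the pointing correction's divergence letter (memo O2: face-supported; displayed until priced)
    (hDivCorr : ∀ (Z : Site d → Fin d → Matrix n n ℂ) (σ : Site d → Matrix n n ℂ) (Z' : Site d → Fin d → Matrix n n ℂ),
      IsSkewDir Z → IsPeriodicDir Z ((N * L ^ (j + 1) : ℕ) : ℤ) → IsLandauB8 (d := d) L N (j + 1) W Z → (∀ y μ, ‖Z y μ‖ ≤ αE) →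
      (∀ y, σ y ∈ skewAdjoint (Matrix n n ℂ)) → (∀ (y : Site d) (i : Fin d), σ (y + ((N * L ^ (j + 1) : ℕ) : ℤ) • e i) = σ y) →
      (∀ y, ‖σ y‖ ≤ 2 * θu) → (∀ (y : Site d) (κ : Fin d), ‖gaugeDir W σ y κ‖ ≤ 4 * θu) →
      IsSkewDir Z' → IsPeriodicDir Z' ((N * L ^ (j + 1) : ℕ) : ℤ) →
      (∀ y μ, ‖Z' y μ‖ ≤ α₀) → cavgIter L (j + 1) (vary W Z' 1) = cavgIter L (j + 1) W →
      (∀ (y : Site d) (μ : Fin d), ‖Z' y μ - (Z y μ - gaugeDir W σ y μ)‖ ≤ 4 * (2 * θu + 4 * θu) * (αE + 4 * θu)) →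
      ∀ y : Site d, ‖covDiv W (fun z κ => Z' z κ - (Z z κ - gaugeDir W σ z κ)) y‖ ≤ dC)
    (haN : aN = (supC d L / ((L : ℝ) ^ (j + 1) * (1 - cruxC d L * (((L : ℝ) ^ (j + 1)) ^ 2 * x)))
        * (4 * (3 + 12 * (d : ℝ)) ^ 3 / rho0 d L ^ 2 * ((L : ℝ) ^ (j + 1) * α₀) ^ 2)))
    (hcN : cN = 4 * (supC d L / ((L : ℝ) ^ (j + 1) * (1 - cruxC d L * (((L : ℝ) ^ (j + 1)) ^ 2 * x)))
        * (4 * (3 + 12 * (d : ℝ)) ^ 3 / rho0 d L ^ 2 * ((L : ℝ) ^ (j + 1) * α₀) ^ 2)))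
    (hνm : ν = 24 * (Fintype.card (T4AveragingDeficitWall.Plane d) : ℝ) * (supC d L / ((L : ℝ) ^ (j + 1) * (1 - cruxC d L * (((L : ℝ) ^ (j + 1)) ^ 2 * x)))
        * (4 * (3 + 12 * (d : ℝ)) ^ 3 / rho0 d L ^ 2 * ((L : ℝ) ^ (j + 1) * α₀) ^ 2)))
    {α₁ : ℝ} (hα1 : 0 ≤ α₁)
    (hGrad : ∀ (Z : Site d → Fin d → Matrix n n ℂ) (σ : Site d → Matrix n n ℂ) (Z' : Site d → Fin d → Matrix n n ℂ),
      IsSkewDir Z → IsPeriodicDir Z ((N * L ^ (j + 1) : ℕ) : ℤ) → IsLandauB8 (d := d) L N (j + 1) W Z → (∀ y μ, ‖Z y μ‖ ≤ αE) →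
      (∀ y, σ y ∈ skewAdjoint (Matrix n n ℂ)) → (∀ (y : Site d) (i : Fin d), σ (y + ((N * L ^ (j + 1) : ℕ) : ℤ) • e i) = σ y) →
      (∀ y, ‖σ y‖ ≤ 2 * θu) → (∀ (y : Site d) (κ : Fin d), ‖gaugeDir W σ y κ‖ ≤ 4 * θu) →
      IsSkewDir Z' → IsPeriodicDir Z' ((N * L ^ (j + 1) : ℕ) : ℤ) →
      (∀ y μ, ‖Z' y μ‖ ≤ α₀) → cavgIter L (j + 1) (vary W Z' 1) = cavgIter L (j + 1) W →
      (∀ (y : Site d) (μ : Fin d), ‖Z' y μ - (Z y μ - gaugeDir W σ y μ)‖ ≤ 4 * (2 * θu + 4 * θu) * (αE + 4 * θu)) →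
      ∀ (y : Site d) (κ τ : Fin d), ‖Ad (W (y + e κ) τ) (Z' (y + e τ) κ) - Z' y κ‖ ≤ α₁)
    -- THE FOUR-TERM SLICE-SOLVER LETTER (F152's shape) on all skew periodic `W`-tangent fields
    (h4 : ∀ X : Site d → Fin d → Matrix n n ℂ, IsSkewDir X →
      IsPeriodicDir X ((N * L ^ (j + 1) : ℕ) : ℤ) → dirIter L (j + 1) W X = 0 → ∀ R : ℝ, (∀ y κ', ‖X y κ'‖ ≤ R) → ∀ g : ℝ, 0 ≤ g →
      (∀ Y : Site d → Fin d → Matrix n n ℂ, IsSkewDir Y → IsPeriodicDir Y ((N * L ^ (j + 1) : ℕ) : ℤ) → dirIter L (j + 1) W Y = 0 →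
        |hess W X Y (perWin d (N * L ^ (j + 1)))| ≤ g * dirL1 Y (periodBox (d := d) (N * L ^ (j + 1)))) →
      ∀ σ' : Site d → Matrix n n ℂ, (∀ y, σ' y ∈ skewAdjoint (Matrix n n ℂ)) →
      (∀ (y : Site d) (i : Fin d), σ' (y + ((N * L ^ (j + 1) : ℕ) : ℤ) • e i) = σ' y) → ∀ Ξ' : ℝ, (∀ y, ‖σ' y‖ ≤ Ξ') →
      ∀ D : ℝ, (∀ y, ‖covDiv W (fun z κ => X z κ + gaugeDir W σ' z κ) y‖ ≤ D) →
      ∀ z μ' ν', μ' ≠ ν' → ‖curlAt W X z μ' ν'‖ ≤ KG * g + KX * R + KD * D + KΞ * Ξ')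
    (hcritW : ∀ Y : Site d → Fin d → Matrix n n ℂ, IsSkewDir Y → IsPeriodicDir Y ((N * L ^ (j + 1) : ℕ) : ℤ) → dirIter L (j + 1) W Y = 0 →
      dAction W Y (perWin d (N * L ^ (j + 1))) = 0) :
    SmallField U (x + (KG * (
        ((x + 4 * (Real.exp α₀ - 1))
            * ((curl1C d L / (1 - thetaLoc d L * (((L : ℝ) ^ (j + 1)) ^ 2 * (x + 4 * (Real.exp α₀ - 1)))))
                * (((L : ℝ) ^ (j + 1)) ^ d / ((L : ℝ) ^ (j + 1)) ^ 2))
            * (Real.exp (((L : ℝ) ^ d / L) * ((d : ℝ) * (16 * ((d : ℝ) + 1) * ((d : ℝ) + 4) * (L : ℝ) ^ 2)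
                  * (1250 * ((nbRad d L : ℝ) + L) + 8 * ((d : ℝ) * L) + 2 * L)) * (2 / twoLevelSmall d L))
                * ((L : ℝ) / (L : ℝ) ^ d) ^ j
                * (((d : ℝ) * (2 * nbRad d L + 1) ^ d) * ((2 * (d : ℝ) + 4) * (L : ℝ) ^ 2) * (2 * (L : ℝ) ^ j) * (Real.exp α₀ - 1)
                  + (17 / 8 * ((L : ℝ) ^ 2) ^ j * (x + 4 * (Real.exp α₀ - 1)))
                    * (((d : ℝ) * (2 * nbRad d L + 1) ^ d) * ((2 * (d : ℝ) + 4)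
                          * (2 * (2 * L * (nbRad d L : ℝ) + 128 * ((d : ℝ) + 1) * ((d : ℝ) + 4) * (L : ℝ) ^ 2)))
                      + ((d : ℝ) * (2 * nbRad d L + 1) ^ d) * ((2 * (d : ℝ) + 4) * (L : ℝ) ^ 2 * (2 * (nbRad d L : ℝ))
                          + 2 * (8 * (L : ℝ) + (1250 * ((nbRad d L : ℝ) + L) + 8 * (d * L) + 2 * L))
                              * (16 * ((d : ℝ) + 1) * ((d : ℝ) + 4) * (L : ℝ) ^ 2))))))
        + (Fintype.card (T4AveragingDeficitWall.Plane d) : ℝ)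
          * (2 * (240 * (Real.exp α₀ - 1) * α₀ * (2 * α₁ + 24 * α₀ * (Real.exp α₀ - 1) + x) + 8 * α₀ * (2 * α₁ + 24 * α₀ * (Real.exp α₀ - 1))
              + 6 * (Real.exp α₀ - 1) * (2 * α₁ + 24 * (Real.exp α₀ - 1) * α₀)
              + (2 * α₁ + 24 * (Real.exp α₀ - 1) * α₀) * (2 * α₁ + 24 * α₀ * (Real.exp α₀ - 1))
              + 960 * (Real.exp α₀ - 1) * α₀ ^ 2 + 32 * x * α₀ ^ 2)
            + (64 * α₀ * α₁ + 1024 * x * α₀ ^ 2))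
        + ν) + KX * (α₀ + aN) + KD * (dC + (b₀ + 3 * (cRE * b₀)) + 2 * (d : ℝ) * aN) + KΞ * (2 * θu) + cN + 28 * α₀ ^ 2)) := by
  -- the right-inverse regime at `x` from the one at `x′ = x + 4(e^{α₀} − 1) ≥ x`
  have hexp : 0 ≤ 4 * (Real.exp α₀ - 1) := by have := Real.add_one_le_exp α₀; linarith
  have hM2 : 0 ≤ ((L : ℝ) ^ (j + 1)) ^ 2 := by positivity
  have hxx' : ((L : ℝ) ^ (j + 1)) ^ 2 * x ≤ ((L : ℝ) ^ (j + 1)) ^ 2 * (x + 4 * (Real.exp α₀ - 1)) :=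
    mul_le_mul_of_nonneg_left (by linarith) hM2
  have hθx : cruxC d L * (((L : ℝ) ^ (j + 1)) ^ 2 * x) < 1 :=
    (mul_le_mul_of_nonneg_left hxx' (cruxC_nonneg d L)).trans_lt hθ
  have hεx : ((L : ℝ) ^ (j + 1)) ^ 2 * x ≤ 1 := hxx'.trans hε
  -- `m ≥ 0`, hence `ν ≥ 0`
  have h1θ : 0 < 1 - cruxC d L * (((L : ℝ) ^ (j + 1)) ^ 2 * x) := by linarith
  have hsupC0 : 0 ≤ supC d L := by
    unfold supC NE3RightInverseSupLetters.corrC NE3RightInverseSupLetters.frameC; have := NE3QbarIterCovLiftPrep.liftC_nonneg d; positivity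
  have hν : 0 ≤ ν := by rw [hνm]; positivity
  refine smallField_of_tanCritical_roadB_fourTerm hd hL j hWu hWP hx hs hWx hα0 hs' hθ hθl hε hUu hUP hxU hsU hUxU hcritU hTopUW hx10 hgrad hbx hcx hbx' hcx'
    hr₀ hb₀ hcRE hreg₁ hreg₂ hreg₃ hline hαE hθu hαE40 hθu160 hα₀ hν hDivCorr ?_ hα1 hGrad h4 hcritW
  -- (L1)′ by F111, with the normal lift's skewness and the CRUDE divergence bound `‖covDiv W A_N‖ ≤ 2d·a_N` (memo O2(ii): to be sharpened by a smooth∕projected lift)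
  intro Z σ Z' _ _ _ _ _ _ _ _ hZ's hZ'P hZ'α hTop _
  obtain ⟨AN, hANs, hANP, hANex, hANsup, hANcurl, hANhess⟩ :=
    exists_normalLift_sameTop hL j hWu hWP hx hs hs1 hWx hθx hεx hA hZ's hZ'P hα0 hZ'α hσ0 hTop
  have hANsup' : ∀ (y : Site d) (μ : Fin d), ‖AN y μ‖ ≤ aN := fun y μ => by rw [haN]; exact hANsup y μ
  refine ⟨AN, hANP, hANsup', hANex, fun z μ' ν' hne => ?_, fun Y _ hYP _ => ?_, hANs, fun y => ?_⟩
  · rw [hcN]; exact hANcurl z μ' ν' hne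
  · rw [hνm]; exact hANhess Y hYP
  · unfold NE3CovariantWeitzenbock.covDiv
    calc ‖∑ μ : Fin d, (Ad (W y μ) (AN y μ) - AN (y - e μ) μ)‖
        ≤ ∑ μ : Fin d, ‖Ad (W y μ) (AN y μ) - AN (y - e μ) μ‖ := norm_sum_le _ _
      _ ≤ ∑ _μ : Fin d, (aN + aN) := Finset.sum_le_sum fun μ _ =>
          (norm_sub_le _ _).trans (add_le_add (by rw [norm_Ad_of_unitary (hWu y μ)]; exact hANsup' y μ) (hANsup' _ μ))
      _ = 2 * (d : ℝ) * aN := by rw [Finset.sum_const, Finset.card_univ, Fintype.card_fin, nsmul_eq_mul]; ring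

end

end Summit.QuantumFields.BalabanUV.T4Continuum.NE7ApeCurvedRepRoadBLiftedFourTerm
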